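import Mathlib
import Literature.AlgebraicGeometry.Resolution.CobordantGame
import Literature.AlgebraicGeometry.Resolution.CobordantChartCoefficients
import Literature.AlgebraicGeometry.Resolution.CobordantChartPlaneSlice
import Literature.AlgebraicGeometry.Resolution.AxisPolyhedron
import Summits.ResolutionOfSingularities.ResolutionOfSingularities.Theorems.WeightedInvariantLocalWeightedDropAxisPointMove
import Summits.ResolutionOfSingularities.ResolutionOfSingularities.Theorems.WeightedInvariantLocalWeightedDropAxisPreparationTaylor
import Summits.ResolutionOfSingularities.ResolutionOfSingularities.Theorems.WeightedInvariantLocalWeightedDropAxisWeightedMoveRotate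
import Summits.ResolutionOfSingularities.ResolutionOfSingularities.Theorems.WeightedInvariantLocalWeightedDropAxisNearDescentCoeff

/-!
# `LocalWeightedDrop` (stmt-ResolutionOfSingularities-8899), TOT2-LINE piece S-E1 (core, part 5):
# the `δ`-descent for an ABSTRACT COEFFICIENT DICTIONARY (scalar rescalings absorbed)

Route `ResolutionOfSingularities/WeightedInvariant`, crux `LocalWeightedDrop`, registered residual
`stub_spaceNCRankDrop` (skeleton v32), sub-line TOT2-LINE v1 §5 (E1) [OURS · L1 W4.3; AI-drafted, weaker than
expert review].  At the request of the decorated half (res-type-056, INTERFACE 12:02Z (a)): the transports of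
`…AxisNearDescentCoeff` / `…AxisNearDescent` restated for an ABSTRACT PAIR `(S, T)` of series in
`k[[x'₁, …, x'ₙ, z]]` related by the coefficient dictionary
`hdict : ∀ E, |E_{x'}| ≤ d → coeff E T = coeff (E + single z (d - |E_{x'}|)) S * u ^ (E_z + (d - |E_{x'}|))`
with a scalar `u ≠ 0` — satisfied by the rotated `z`-slot slice at the axis point with `u = c_z`
(`dict_nearSucc`, from `AxisNearDescent.coeff_nearSucc`) and stable under the scalar rescalings that the
restricted-chart transport of legal coordinate changes produces.

**Results** (every field, every dimension; `hord`: every monomial of `S` has degree `≥ d`):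
`dict_nearSucc` · `coeff_sub_of_dict` (source form) · `coeff_of_dict_of_last_eq_zero` · **`aboveLevel_iff_of_dict`**
(`AboveLevel d r q T ↔ AboveLevel d (r + q) q S`: `δ(T) = δ(S) - 1`) · `le_order_iff_of_dict`, `order_eq_of_dict`
(`T` near iff `δ(S) ≥ 2`) · `initEval_snoc_zero_of_dict`, `trivialApexX_of_dict` · `axisCone_of_dict` (`δ > 2`) ·
`inAxisIdeal_iff_of_dict` · `taylorCoeff_of_dict` · **`solvable_iff_of_dict`**
(`Solvable d M lam T ↔ Solvable d (M + 1) (u⁻¹^(M+1) • lam) S`) · **`preparedAxis_of_dict`**.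
-/

set_option linter.dupNamespace false -- mandated namespace of this single-conjunct summit

namespace Summit.ResolutionOfSingularities.ResolutionOfSingularities.Theorems

open Literature.AlgebraicGeometry.Resolution

namespace AxisNearDescent

open MvPowerSeries AxisPolyhedron

variable {k : Type} [Field k] {n : ℕ}

/-! ### Exponent bookkeeping: adding to the `z`-exponent -/

/-- Adding to the `z`-exponent does not change the `x'`-degree. -/
theorem xDeg_add_single_last (E : Fin (n + 1) →₀ ℕ) (r : ℕ) :
    xDeg (E + Finsupp.single (Fin.last n) r) = xDeg E := by
  rw [AxisPreparation.xDeg_add, AxisPreparation.xDeg_single_last, add_zero]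

/-- The new `z`-exponent. -/
theorem add_single_last_apply_last (E : Fin (n + 1) →₀ ℕ) (r : ℕ) :
    (E + Finsupp.single (Fin.last n) r) (Fin.last n) = E (Fin.last n) + r := by
  rw [Finsupp.add_apply, Finsupp.single_eq_same]

/-- The `x'`-exponents are unchanged. -/
theorem add_single_last_apply_castSucc (E : Fin (n + 1) →₀ ℕ) (r : ℕ) (j : Fin n) :
    (E + Finsupp.single (Fin.last n) r) (Fin.castSucc j) = E (Fin.castSucc j) := by
  rw [Finsupp.add_apply, Finsupp.single_eq_of_ne (Fin.castSucc_lt_last j).ne, add_zero]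

/-- Degree after adding to the `z`-exponent. -/
theorem degree_add_single_last (E : Fin (n + 1) →₀ ℕ) (r : ℕ) :
    (E + Finsupp.single (Fin.last n) r).degree = E.degree + r := by
  rw [map_add, Finsupp.degree_single]

/-- Removing `r ≤ E_z` from the `z`-exponent and adding it back. -/
theorem update_sub_add_single_last {E : Fin (n + 1) →₀ ℕ} {r : ℕ} (h : r ≤ E (Fin.last n)) :
    E.update (Fin.last n) (E (Fin.last n) - r) + Finsupp.single (Fin.last n) r = E := by
  ext l
  rcases Fin.eq_castSucc_or_eq_last l with ⟨j, rfl⟩ | rfl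
  · rw [add_single_last_apply_castSucc, update_last_apply_castSucc]
  · rw [add_single_last_apply_last, update_last_apply_last]
    omega

/-! ### The rotated slice at the axis point satisfies the dictionary with `u = c_z` -/

/-- THE NEAR SUCCESSOR FITS THE ABSTRACT DICTIONARY (`u = c_z`). -/
theorem dict_nearSucc {S : MvPowerSeries (Fin (n + 1)) k} {c : Fin (n + 1) → k}
    (hc : ∀ j : Fin n, c (Fin.castSucc j) = 0) {d : ℕ} {G : MvPowerSeries (Fin (n + 2)) k}
    (hfac : subst (CobordantChart.chart (fun _ : Fin (n + 1) => 1) c) S = X 0 ^ d * G)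
    {N : MvPowerSeries (Fin (n + 1)) k}
    (hN : N = rename (⇑(finRotate (n + 1)).symm)
      (subst (fun j : Fin (n + 2) => if j = (Fin.last n).succ then (0 : MvPowerSeries (Fin (n + 1)) k)
        else X (Fin.predAbove (Fin.last n) j)) G)) :
    ∀ E : Fin (n + 1) →₀ ℕ, xDeg E ≤ d →
      coeff E N = coeff (E + Finsupp.single (Fin.last n) (d - xDeg E)) S *
        c (Fin.last n) ^ (E (Fin.last n) + (d - xDeg E)) := by
  intro E hx
  have hupd : E.update (Fin.last n) (E (Fin.last n) + d - xDeg E) =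
      E + Finsupp.single (Fin.last n) (d - xDeg E) := by
    ext l
    rcases Fin.eq_castSucc_or_eq_last l with ⟨j, rfl⟩ | rfl
    · rw [add_single_last_apply_castSucc, update_last_apply_castSucc]
    · rw [add_single_last_apply_last, update_last_apply_last]
      omega
  rw [coeff_nearSucc hc hfac hN (by omega), hupd, show E (Fin.last n) + d - xDeg E =
    E (Fin.last n) + (d - xDeg E) by omega]

/-! ### Consequences of the dictionary -/

section Dict

variable {S T : MvPowerSeries (Fin (n + 1)) k} {d : ℕ} {u : k}
  (hdict : ∀ E : Fin (n + 1) →₀ ℕ, xDeg E ≤ d →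
    coeff E T = coeff (E + Finsupp.single (Fin.last n) (d - xDeg E)) S * u ^ (E (Fin.last n) + (d - xDeg E)))

include hdict

/-- Source form of the dictionary: a monomial `x'^b z^γ` of `S` with `|b| < d ≤ |b| + γ` is read by the exponent
`(b, γ - (d - |b|))` of `T`. -/
theorem coeff_sub_of_dict {E₀ : Fin (n + 1) →₀ ℕ} (hx₀ : xDeg E₀ ≤ d) (hd : d ≤ E₀.degree) :
    coeff (E₀.update (Fin.last n) (E₀ (Fin.last n) - (d - xDeg E₀))) T = coeff E₀ S * u ^ E₀ (Fin.last n) := by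
  have hdeg := AxisPreparation.degree_eq_xDeg_add E₀
  have hle : d - xDeg E₀ ≤ E₀ (Fin.last n) := by omega
  rw [hdict _ (by rw [xDeg_update_last]; exact hx₀), xDeg_update_last, update_sub_add_single_last hle,
    update_last_apply_last, Nat.sub_add_cancel hle]

/-- The `z`-free coefficients of degree `d` agree. -/
theorem coeff_of_dict_of_last_eq_zero {E : Fin (n + 1) →₀ ℕ} (hdeg : E.degree = d) (hz : E (Fin.last n) = 0) :
    coeff E T = coeff E S := by
  have hx : xDeg E = d := by
    have h := AxisPreparation.degree_eq_xDeg_add E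
    rw [hdeg, hz, add_zero] at h
    exact h.symm
  rw [hdict E hx.le, hx, hz, Nat.sub_self, zero_add, pow_zero, mul_one, Finsupp.single_zero, add_zero]

/-- **`δ(T) = δ(S) - 1`**, threshold form (`u ≠ 0`, monomials of `S` in degree `≥ d`). -/
theorem aboveLevel_iff_of_dict (hu : u ≠ 0) (hord : ∀ E : Fin (n + 1) →₀ ℕ, coeff E S ≠ 0 → d ≤ E.degree)
    (r q : ℕ) : AboveLevel d r q T ↔ AboveLevel d (r + q) q S := by
  constructor
  · intro h E₀ hx₀ hlt₀
    by_contra hne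
    have hd := hord E₀ hne
    have hdeg := AxisPreparation.degree_eq_xDeg_add E₀
    have hzero := h (E₀.update (Fin.last n) (E₀ (Fin.last n) - (d - xDeg E₀)))
      (by rw [xDeg_update_last]; exact hx₀)
      (by rw [xDeg_update_last, update_last_apply_last]
          have h1 : q * (E₀ (Fin.last n) - (d - xDeg E₀)) + q * (d - xDeg E₀) = q * E₀ (Fin.last n) := by
            rw [← Nat.mul_add]; congr 1; omega
          have h2 : (r + q) * (d - xDeg E₀) = r * (d - xDeg E₀) + q * (d - xDeg E₀) := Nat.add_mul _ _ _
          omega)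
    rw [coeff_sub_of_dict hdict hx₀.le hd] at hzero
    exact mul_ne_zero hne (pow_ne_zero _ hu) hzero
  · intro h E hx hlt
    rw [hdict E hx.le, h _ (by rw [xDeg_add_single_last]; exact hx) ?_, zero_mul]
    rw [xDeg_add_single_last, add_single_last_apply_last, Nat.mul_add, Nat.add_mul]
    exact Nat.add_lt_add_right hlt _

/-- `δ(S) ≥ 2` forces `ord T ≥ d`. -/
theorem le_order_of_dict (hlev : AboveLevel d 2 1 S) : (d : ℕ∞) ≤ T.order := by
  refine MvPowerSeries.nat_le_order fun E hElt => ?_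
  have hdeg := AxisPreparation.degree_eq_xDeg_add E
  have hElt' : E.degree < d := by exact_mod_cast hElt
  rw [hdict E (by omega), hlev _ (by rw [xDeg_add_single_last]; omega) ?_, zero_mul]
  rw [xDeg_add_single_last, add_single_last_apply_last]
  omega

/-- `δ(S) < 2` forces `ord T < d`. -/
theorem order_lt_of_dict (hu : u ≠ 0) (hord : ∀ E : Fin (n + 1) →₀ ℕ, coeff E S ≠ 0 → d ≤ E.degree)
    (hlev : ¬ AboveLevel d 2 1 S) : T.order < (d : ℕ∞) := by
  obtain ⟨E₀, hx₀, hlt₀, hne⟩ : ∃ E₀ : Fin (n + 1) →₀ ℕ, xDeg E₀ < d ∧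
      1 * E₀ (Fin.last n) < 2 * (d - xDeg E₀) ∧ coeff E₀ S ≠ 0 := by
    by_contra hno
    push Not at hno
    exact hlev hno
  have hd := hord E₀ hne
  have hdeg := AxisPreparation.degree_eq_xDeg_add E₀
  have hne' : coeff (E₀.update (Fin.last n) (E₀ (Fin.last n) - (d - xDeg E₀))) T ≠ 0 := by
    rw [coeff_sub_of_dict hdict hx₀.le hd]; exact mul_ne_zero hne (pow_ne_zero _ hu)
  refine lt_of_le_of_lt (MvPowerSeries.order_le hne') ?_
  rw [degree_update_last]
  exact_mod_cast (show xDeg E₀ + (E₀ (Fin.last n) - (d - xDeg E₀)) < d by omega)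

/-- **`T` IS NEAR IFF `δ(S) ≥ 2`**. -/
theorem le_order_iff_of_dict (hu : u ≠ 0) (hord : ∀ E : Fin (n + 1) →₀ ℕ, coeff E S ≠ 0 → d ≤ E.degree) :
    (d : ℕ∞) ≤ T.order ↔ AboveLevel d 2 1 S := by
  constructor
  · intro h
    by_contra hlev
    exact absurd h (not_le_of_gt (order_lt_of_dict hdict hu hord hlev))
  · exact le_order_of_dict hdict

/-- ORDER OF `T`: exactly `d` when `S` is an axis germ of order `d` with `δ(S) ≥ 2`. -/
theorem order_eq_of_dict (hSd : S.order = d) (hcone : AxisCone d S) (hlev : AboveLevel d 2 1 S) : T.order = d := by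
  refine le_antisymm ?_ (le_order_of_dict hdict hlev)
  obtain ⟨⟨E₀, hne, hdeg⟩, -⟩ := MvPowerSeries.order_eq_nat.mp hSd
  have hz : E₀ (Fin.last n) = 0 := by
    by_contra hz
    exact hne (hcone E₀ hdeg hz)
  have hne' : coeff E₀ T ≠ 0 := by rw [coeff_of_dict_of_last_eq_zero hdict hdeg hz]; exact hne
  have := MvPowerSeries.order_le hne'
  rw [hdeg] at this
  exact this

/-- On `z = 0` the degree-`d` forms of `T` and `S` agree. -/
theorem initEval_snoc_zero_of_dict (v : Fin n → k) :
    CobordantChart.initEval (fun _ : Fin (n + 1) => 1) (Fin.snoc v 0 : Fin (n + 1) → k) d T =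
      CobordantChart.initEval (fun _ : Fin (n + 1) => 1) (Fin.snoc v 0 : Fin (n + 1) → k) d S := by
  rw [ApexFreeOrderDrop.initEval_one_eq_sum, ApexFreeOrderDrop.initEval_one_eq_sum]
  refine Finset.sum_congr rfl fun e he => ?_
  have hdeg : e.degree = d := by
    rw [← ApexFreeOrderDrop.weight_one_eq_degree]
    exact (ApexFreeOrderDrop.mem_antidiag_iff d e).mp he
  by_cases hz : e (Fin.last n) = 0
  · rw [coeff_of_dict_of_last_eq_zero hdict hdeg hz]
  · have hzero : ∏ i : Fin (n + 1), (Fin.snoc v 0 : Fin (n + 1) → k) i ^ e i = 0 :=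
      Finset.prod_eq_zero (Finset.mem_univ (Fin.last n)) (by rw [Fin.snoc_last, zero_pow hz])
    rw [hzero, mul_zero, mul_zero]

/-- **THE TRIVIAL APEX INSIDE `z = 0` IS TRANSPORTED.** -/
theorem trivialApexX_of_dict (hapex : TrivialApexX d S) : TrivialApexX d T := by
  intro w hw
  obtain ⟨v, hv⟩ := hapex w hw
  refine ⟨v, ?_⟩
  rw [AxisWeightedMove.snoc_add_snoc] at hv ⊢
  rwa [initEval_snoc_zero_of_dict hdict, initEval_snoc_zero_of_dict hdict]

/-- **FOR `δ(S) > 2`, `T` IS AGAIN AN AXIS GERM.** -/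
theorem axisCone_of_dict {r q : ℕ} (hlev : AboveLevel d r q S) (hrq : 2 * q < r) : AxisCone d T := by
  intro E hdeg hz
  have hsum := AxisPreparation.degree_eq_xDeg_add E
  rw [hdict E (by omega), hlev _ (by rw [xDeg_add_single_last]; omega) ?_, zero_mul]
  rw [xDeg_add_single_last, add_single_last_apply_last]
  have h1 : E (Fin.last n) + (d - xDeg E) = 2 * E (Fin.last n) := by omega
  have h2 : d - xDeg E = E (Fin.last n) := by omega
  rw [h1, h2, ← Nat.mul_assoc]
  exact Nat.mul_lt_mul_of_pos_right (by omega) (Nat.pos_of_ne_zero hz)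

/-- **`δ = ∞` IS TRANSPORTED BOTH WAYS.** -/
theorem inAxisIdeal_iff_of_dict (hu : u ≠ 0) (hord : ∀ E : Fin (n + 1) →₀ ℕ, coeff E S ≠ 0 → d ≤ E.degree) :
    InAxisIdeal d T ↔ InAxisIdeal d S := by
  constructor
  · intro h E₀ hx₀
    by_contra hne
    have hd := hord E₀ hne
    have hzero := h (E₀.update (Fin.last n) (E₀ (Fin.last n) - (d - xDeg E₀)))
      (by rw [xDeg_update_last]; exact hx₀)
    rw [coeff_sub_of_dict hdict hx₀.le hd] at hzero
    exact mul_ne_zero hne (pow_ne_zero _ hu) hzero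
  · intro h E hx
    rw [hdict E hx.le, h _ (by rw [xDeg_add_single_last]; exact hx), zero_mul]

/-- The Hasse–Taylor coefficients are unchanged. -/
theorem taylorCoeff_of_dict (lam : Fin n → k) (E : Fin (n + 1) →₀ ℕ) :
    taylorCoeff d T lam E = taylorCoeff d S lam E := by
  rw [AxisPreparation.taylorCoeff_eq_sum, AxisPreparation.taylorCoeff_eq_sum]
  refine Finset.sum_congr rfl fun B hB => ?_
  obtain ⟨hdeg, hz⟩ := AxisPreparation.mem_axisExps.mp hB
  rw [coeff_of_dict_of_last_eq_zero hdict hdeg hz]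

/-- **SOLVABLE VERTICES CORRESPOND**: level `M` of `T` by `lam` iff level `M + 1` of `S` by `u^{-(M+1)} · lam`. -/
theorem solvable_iff_of_dict (hu : u ≠ 0) (hord : ∀ E : Fin (n + 1) →₀ ℕ, coeff E S ≠ 0 → d ≤ E.degree)
    (M : ℕ) (lam : Fin n → k) :
    Solvable d M lam T ↔ Solvable d (M + 1) ((u⁻¹ ^ (M + 1)) • lam) S := by
  have key : ∀ E : Fin (n + 1) →₀ ℕ, xDeg E < d → E (Fin.last n) = M * (d - xDeg E) →
      (coeff E T = taylorCoeff d T lam E ↔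
        coeff (E + Finsupp.single (Fin.last n) (d - xDeg E)) S =
          taylorCoeff d S ((u⁻¹ ^ (M + 1)) • lam) (E + Finsupp.single (Fin.last n) (d - xDeg E))) := by
    intro E hx hz
    have hγ : E (Fin.last n) + (d - xDeg E) = (M + 1) * (d - xDeg E) := by
      rw [hz, Nat.add_mul, one_mul]
    rw [hdict E hx.le, taylorCoeff_of_dict hdict,
      AxisWeightedMove.taylorCoeff_smul _ _ _ _ _ (by rw [xDeg_add_single_last]; exact hx.le),
      xDeg_add_single_last,
      AxisPreparation.taylorCoeff_congr (E' := E) (fun j => add_single_last_apply_castSucc E _ j),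
      hγ, ← pow_mul, inv_pow]
    have huγ : u ^ ((M + 1) * (d - xDeg E)) ≠ 0 := pow_ne_zero _ hu
    constructor
    · intro h
      rw [← h]
      field_simp
    · intro h
      rw [h]
      field_simp
  constructor
  · rintro ⟨hlevT, hT'⟩
    refine ⟨(aboveLevel_iff_of_dict hdict hu hord M 1).mp hlevT, fun E₀ hx₀ hz₀ => ?_⟩
    have hdeg := AxisPreparation.degree_eq_xDeg_add E₀
    have hle : d - xDeg E₀ ≤ E₀ (Fin.last n) := by rw [hz₀, Nat.add_mul, one_mul]; omega
    set E := E₀.update (Fin.last n) (E₀ (Fin.last n) - (d - xDeg E₀)) with hE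
    have hxE : xDeg E = xDeg E₀ := xDeg_update_last _ _
    have hzE : E (Fin.last n) = M * (d - xDeg E) := by
      rw [hE, update_last_apply_last, hxE, hz₀, Nat.add_mul, one_mul]; omega
    have hback : E + Finsupp.single (Fin.last n) (d - xDeg E) = E₀ := by
      rw [hxE, hE]; exact update_sub_add_single_last hle
    have h := (key E (by rw [hxE]; exact hx₀) hzE).mp (hT' E (by rw [hxE]; exact hx₀) hzE)
    rwa [hback] at h
  · rintro ⟨hlevS, hS'⟩
    refine ⟨(aboveLevel_iff_of_dict hdict hu hord M 1).mpr hlevS, fun E hx hz => ?_⟩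
    refine (key E hx hz).mpr (hS' _ (by rw [xDeg_add_single_last]; exact hx) ?_)
    rw [add_single_last_apply_last, xDeg_add_single_last, hz, Nat.add_mul, one_mul]

/-- **PREPAREDNESS IS TRANSPORTED.** -/
theorem preparedAxis_of_dict (hu : u ≠ 0) (hord : ∀ E : Fin (n + 1) →₀ ℕ, coeff E S ≠ 0 → d ≤ E.degree)
    (hprep : PreparedAxis d S) : PreparedAxis d T := by
  intro M lam hlam hsol
  refine hprep (M + 1) ((u⁻¹ ^ (M + 1)) • lam) ?_ ((solvable_iff_of_dict hdict hu hord M lam).mp hsol)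
  intro hzero
  apply hlam
  rw [smul_eq_zero] at hzero
  rcases hzero with h0 | h
  · exact absurd h0 (pow_ne_zero _ (inv_ne_zero hu))
  · exact h

end Dict

end AxisNearDescent

end Summit.ResolutionOfSingularities.ResolutionOfSingularities.Theorems
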